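import Summits.CriticalPhenomena.PercolationContinuityZ3.Theorems.PercNearOneGluingNoHeavyLowerTailSahiUniformGrid

/-!
# `NoHeavyLowerTail` (crux stmt-CriticalPhenomena-4575), Sahi programme P1: the phase diagram of the width stratification

Support file (Sahi cell, seat `prim-sahi-p1`, generation 3; `--supports stmt-CriticalPhenomena-4575`).

Write `U(d,n)` for: the uniform probability weight on every box `[M]^d = (Fin d → Fin M)`, `M ≥ 1`, satisfies Sahi's
`E_n ≥ 0` for all nonnegative monotone families (`…SahiUniformGrid`: `U(d,n) ⟺` product weights on `d`-grids `⟺` FKG weights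
on `d`-grids, and `SahiConjecture n ⟺ ∀ d, U(d,n)`).  This file records the shape of the table `(d,n) ↦ U(d,n)`:

* `uniformGrid_anti_order`: `U(d,n) ⇒ U(d,m)` for `m ≤ n` (Lieb–Sahi's hierarchy `C_n ⇒ C_{n−1}`);
* `uniformGrid_anti_dim`: `U(d+1,n) ⇒ U(d,n)` (a `d`-box is a sublattice of a `(d+1)`-box);
* `uniformGrid_of_order_le_two`: `U(d,n)` for `n ≤ 2`, all `d` (FKG/Harris);
* `uniformGrid_of_dim_le_two`: `U(d,n)` for `d ≤ 2`, all `n` (chains; Lieb–Sahi's Theorem 3.7);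
* `uniformGrid_of_dim_le_two_or_order_le_two`: the proved region `{d ≤ 2} ∪ {n ≤ 2}`.

So the table is monotone in both directions and the FIRST OPEN CELL is `(d,n) = (3,3)`: `E_3 ≥ 0` for three monotone functions on
the uniform discrete cube `[M]³` — by `fkg_grid_iff_uniform 3 3` the same as Sahi's `C₃` (Kahn-type third-order positivity) for
every FKG weight on every lattice of J-width `≤ 3`.  New mathematics (the organisation), standard ingredients.
-/

namespace Summit.CriticalPhenomena.PercolationContinuityZ3.Theorems.SahiWidth

open Finset Function Literature.Combinatorics.Sahi2008
open scoped BigOperators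

noncomputable section

variable {d n : ℕ}

/-- The uniform weight on `[M]^d` is nonnegative. [folklore] -/
theorem uniformGrid_nonneg (d M : ℕ) (ω : Fin d → Fin M) : (0 : ℝ) ≤ (fun _ : Fin d → Fin M => (1 : ℝ) / (M : ℝ) ^ d) ω := by
  positivity

/-- The uniform weight on `[M]^d`, `M ≥ 1`, has total mass one. [folklore] -/
theorem sum_uniformGrid {M : ℕ} (hM : 0 < M) : ∑ _ω : Fin d → Fin M, (1 : ℝ) / (M : ℝ) ^ d = 1 := by
  rw [sum_const, card_univ, Fintype.card_fun, Fintype.card_fin, Fintype.card_fin, nsmul_eq_mul]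
  have hM' : (M : ℝ) ^ d ≠ 0 := pow_ne_zero _ (by exact_mod_cast hM.ne')
  push_cast
  field_simp

/-- The uniform weight on `[K+1]^d` is an FKG probability weight (a product weight). [folklore] -/
theorem isFKGMeasure_uniformGrid (d K : ℕ) : IsFKGMeasure (fun _ : Fin d → Fin (K + 1) => (1 : ℝ) / ((K + 1 : ℕ) : ℝ) ^ d) := by
  have h := isFKGMeasure_gridProd (d := d) (K := K) (fun _ _ => (1 : ℝ) / ((K + 1 : ℕ) : ℝ)) (fun _ _ => by positivity)
    (fun _ => by rw [sum_const, card_univ, Fintype.card_fin, nsmul_eq_mul]; field_simp)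
  have heq : (fun ω : Fin d → Fin (K + 1) => ∏ _i : Fin d, (1 : ℝ) / ((K + 1 : ℕ) : ℝ)) =
      fun _ => (1 : ℝ) / ((K + 1 : ℕ) : ℝ) ^ d := by
    funext ω
    rw [prod_const, card_univ, Fintype.card_fin, one_div_pow]
  rwa [heq] at h

/-- **Antitone in the order**: `U(d,n) ⇒ U(d,m)` for `m ≤ n` (the hierarchy `C_n ⇒ C_{n−1}`, weight by weight). [this work] -/
theorem uniformGrid_anti_order {m : ℕ} (hmn : m ≤ n)
    (hU : ∀ M, 0 < M → SahiPositive (fun _ : Fin d → Fin M => (1 : ℝ) / (M : ℝ) ^ d) n) :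
    ∀ M, 0 < M → SahiPositive (fun _ : Fin d → Fin M => (1 : ℝ) / (M : ℝ) ^ d) m :=
  fun M hM => (hU M hM).anti (uniformGrid_nonneg d M) (sum_uniformGrid hM) hmn

/-- Prepending a constant coordinate embeds the `d`-box into the `(d+1)`-box as a sublattice. [folklore] -/
theorem cons_zero_latticeEmbedding (b : ℕ) :
    Function.Injective (fun ω : Fin d → Fin (b + 1) => (Fin.cons (0 : Fin (b + 1)) ω : Fin (d + 1) → Fin (b + 1))) ∧
      (∀ ω ω' : Fin d → Fin (b + 1),
        (Fin.cons (0 : Fin (b + 1)) (ω ⊓ ω') : Fin (d + 1) → Fin (b + 1)) = Fin.cons 0 ω ⊓ Fin.cons 0 ω') ∧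
      ∀ ω ω' : Fin d → Fin (b + 1),
        (Fin.cons (0 : Fin (b + 1)) (ω ⊔ ω') : Fin (d + 1) → Fin (b + 1)) = Fin.cons 0 ω ⊔ Fin.cons 0 ω' := by
  refine ⟨fun ω ω' h => ?_, fun ω ω' => ?_, fun ω ω' => ?_⟩
  · funext i
    have hi := congrFun h i.succ
    simpa only [Fin.cons_succ] using hi
  · funext i
    refine Fin.cases ?_ (fun j => ?_) i
    · simp only [Fin.cons_zero, Pi.inf_apply]
      exact (inf_idem _).symm
    · simp only [Fin.cons_succ, Pi.inf_apply]
  · funext i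
    refine Fin.cases ?_ (fun j => ?_) i
    · simp only [Fin.cons_zero, Pi.sup_apply]
      exact (sup_idem _).symm
    · simp only [Fin.cons_succ, Pi.sup_apply]

/-- **Antitone in the dimension**: `U(d+1,n) ⇒ U(d,n)` (a `d`-box is a sublattice of a `(d+1)`-box). [this work] -/
theorem uniformGrid_anti_dim
    (hU : ∀ M, 0 < M → SahiPositive (fun _ : Fin (d + 1) → Fin M => (1 : ℝ) / (M : ℝ) ^ (d + 1)) n) :
    ∀ M, 0 < M → SahiPositive (fun _ : Fin d → Fin M => (1 : ℝ) / (M : ℝ) ^ d) n := by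
  classical
  rw [fkg_grid_iff_uniform d n]
  intro b μ hμ
  obtain ⟨hinj, hinf, hsup⟩ := cons_zero_latticeEmbedding (d := d) b
  exact sahiPositive_of_latticeEmbedding_grid ((liebSahi_grid_iff_uniform (d + 1) n).2 hU) _ hinj hinf hsup hμ

/-- **Orders `n ≤ 2` are theorems in every dimension** (`E_0 = 0`, `E_1 = E ≥ 0`, `E_2` = FKG/Harris). [this work] -/
theorem uniformGrid_of_order_le_two (hn : n ≤ 2) :
    ∀ M, 0 < M → SahiPositive (fun _ : Fin d → Fin M => (1 : ℝ) / (M : ℝ) ^ d) n := by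
  intro M hM
  obtain ⟨K, rfl⟩ : ∃ K, M = K + 1 := Nat.exists_eq_succ_of_ne_zero hM.ne'
  have h2 : SahiPositive (fun _ : Fin d → Fin (K + 1) => (1 : ℝ) / ((K + 1 : ℕ) : ℝ) ^ d) 2 :=
    sahiPositive_two (isFKGMeasure_uniformGrid d K)
  exact h2.anti (uniformGrid_nonneg d (K + 1)) (sum_uniformGrid hM) hn

/-- **Dimensions `d ≤ 2` are theorems at every order** (chains; Lieb–Sahi's Theorem 3.7 via `liebSahi_grid_two`). [this work] -/
theorem uniformGrid_of_dim_le_two (hd : d ≤ 2) :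
    ∀ M, 0 < M → SahiPositive (fun _ : Fin d → Fin M => (1 : ℝ) / (M : ℝ) ^ d) n := by
  have h2 : ∀ M, 0 < M → SahiPositive (fun _ : Fin 2 → Fin M => (1 : ℝ) / (M : ℝ) ^ 2) n :=
    (liebSahi_grid_iff_uniform 2 n).1 (liebSahi_grid_two n)
  have h1 : ∀ M, 0 < M → SahiPositive (fun _ : Fin 1 → Fin M => (1 : ℝ) / (M : ℝ) ^ 1) n :=
    uniformGrid_anti_dim (d := 1) h2
  have h0 : ∀ M, 0 < M → SahiPositive (fun _ : Fin 0 → Fin M => (1 : ℝ) / (M : ℝ) ^ 0) n :=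
    uniformGrid_anti_dim (d := 0) h1
  interval_cases d
  · exact h0
  · exact h1
  · exact h2

/-- **The phase diagram**: `U(d,n)` is a theorem on `{d ≤ 2} ∪ {n ≤ 2}`; it is antitone in `d` and in `n`
(`uniformGrid_anti_dim`, `uniformGrid_anti_order`); so the first open cell is `(d,n) = (3,3)` — three monotone functions on
the uniform discrete cube `[M]³` — which by `fkg_grid_iff_uniform 3 3` is Sahi's `C₃` for every FKG weight on every lattice of
J-width `≤ 3`. [this work] -/
theorem uniformGrid_of_dim_le_two_or_order_le_two (h : d ≤ 2 ∨ n ≤ 2) :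
    ∀ M, 0 < M → SahiPositive (fun _ : Fin d → Fin M => (1 : ℝ) / (M : ℝ) ^ d) n := by
  rcases h with h | h
  · exact uniformGrid_of_dim_le_two h
  · exact uniformGrid_of_order_le_two h

end

end Summit.CriticalPhenomena.PercolationContinuityZ3.Theorems.SahiWidth
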